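import Summits.ABC.IUTFork.Cor312RegimeVerbatimPrVolExactCriterion
import Summits.ABC.IUTFork.Cor312HullGainDyadic
import HarnessLib

/-!
# [IUTchIII] Cor. 3.12 — the regime dichotomy at the print-normalised sharp setting of record made EXACT, III:
# `−|log(Θ)|(𝟙) > 0` at a RAMIFIED base field, so the shift in the exact criterion is genuinely non-zero

PROOF-ONLY support piece of the abc-iut cell (Cor. 3.12 cone, D-0067; seat abc-iut-w4-d107, gen 5; part 13 of the
`Cor312NegLogThetaUpperPrVol*` / `Cor312RegimeVerbatimPrVol*` chain, sequel of parts 11–12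
`Cor312RegimeVerbatimPrVolExact` / `…Criterion`). TAKES NO SIDE on [IUTchIII] Cor. 3.12; theorems only, 0 `def`s, no new
`Prop` fact, no instance.

Parts 11–12: at abc-iut-c312-7's `Real.settingPrVolSharp`, for pilot data whose places of `S` lie over a finite set `U` of
odd primes unramified in `F`, `−|log(Θ)|(t_q, t) = −|log(Θ)|(𝟙) + Θside` and
`Statement ⟺ ↑(Qside − Θside) ≤ −|log(Θ)|(𝟙)` with `0 ≤ −|log(Θ)|(𝟙) ≤ C₂` (`𝟙` = the trivial ideles). THIS FILE
combines them with abc-iut-c312-5's RAMIFIED HULL GAIN (`thetaLocal_settingPrVolSharp_pos_of_ramified`, p439709: at a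
prime `p` not under `S` and a place `v | p` of `F` with `2 ≤ e_v ≤ |S^±_{i+2}| = i+2`, the typed (Ind1)/(Ind2)-hull of the
UNIT Θ-boxes at `(i+1, p)` has STRICTLY POSITIVE log-volume):

* `negLogTheta_settingPrVolSharp_trivial_pos_of_ramified` — under that ramification hypothesis `0 < −|log(Θ)|(𝟙)`: the
  Θ-volume of the trivial configuration is a genuinely POSITIVE number (every local term is `≥ 0` by box ≤ hull, one
  is `> 0`);
* **`settingPrVolSharp_regime_exact_pos_of_ramified`** — hence, for every context there is a REAL `κ > 0`
  (`−|log(Θ)|(𝟙)` read in `ℝ`) with `Statement(t_q, t) ⟺ Qside − Θside ≤ κ` for all such ideles: part 8's positive half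
  `Qside ≤ Θside ⟹ Statement` was NOT sharp at a ramified base field — the typed Corollary 3.12 also holds at genuine
  sharp data whose `q`-exponent mass EXCEEDS the slot-symmetrised Θ-exponent mass by up to `κ`, by the hull inflation
  of the unit boxes at the ramified prime (again inflation, not the disputed (xi-e)/(xi-f) inference);
* `negLogTheta_settingPrVolSharp_trivial_pos_of_sq_eq_neg_one` / `settingPrVolSharp_regime_exact_pos_of_sq_eq_neg_one`
  — the DYADIC instance for every base field of genuine Θ-data: `√−1 ∈ F` ([IUTchI] Def. 3.1 (a)) forces `e_v ≥ 2` at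
  every `v | 2` (abc-iut-c312-5 `Cor312HullGainDyadic`, campaign-S `two_le_absRamificationIdx_two_of_sq_eq_neg_one`), and
  no place of `S` lies over `2` (Def. 3.1 (b)); so `−|log(Θ)|(𝟙) > 0` there as soon as some `v | 2` has
  `e_v ≤ l⋆ + 1` (label bound of the ramified-gain lemma of record).
HONEST SCOPE as in parts 7–12: (Ind2) as typed at the real setting (`Real.ismDH`: all bicontinuous shell-preserving
`ℤ_p`-lattice automorphisms, Dupuy–Hilado §4.9 — the source of the ramified gain, abc-iut-c312-5 F-c312-5-g4-1); sharp
(Ind3) reading; trivial archimedean container; free ideles; the positive instances are inflation-dominated and say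
nothing about print's intended content; nothing here asserts or denies [IUTchIII] Cor. 3.12 for initial Θ-data.
typed ≠ proved; instantiated ≠ endorsed. [claim: Mochizuki2012, status: disputed]
[cite: DupuyHilado2025, §3.6, §3.9, §4.7, §4.9, §4.10] [cite: ScholzeStix2018, §2.2 pp. 9–10]
-/

noncomputable section

open Set Function NumberField IsDedekindDomain
open scoped Pointwise

namespace Summit.ABC

namespace IUTFork

namespace Thm311

namespace Real

open Cor312 Cor312.Setting Cor312Vol Literature.IUT.LogThetaLattice Literature.IUT.LogVolume

variable {F : Type} [Field F] [NumberField F] (X : PilotData F) {logv : PadicLogs F} (hlog : LogvAnalytic logv)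

section Ramified

variable (M : Type) [Field M] [NumberField M]
  (archPk : ∀ (j : (thetaIndex X).Label) (vQ : (thetaIndex X).VQ), Set ((logShellsDH X logv).Packet j vQ))
  (archSub : ∀ (j : (thetaIndex X).Label) (v : (thetaIndex X).V),
    Set ((logShellsDH X logv).Packet j ((thetaIndex X).over v)))
  (Ψ : ℤ → ∀ v : (thetaIndex X).V, v ∈ (thetaIndex X).Vbad → Set ((logShellsDH X logv).StarPacket v))
  (act : ℤ → ∀ v : (thetaIndex X).V, v ∈ (thetaIndex X).Vbad →
    (logShellsDH X logv).StarPacket v → Module.End ℚ ((logShellsDH X logv).StarPacket v))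
  (Mmod : ℤ → ∀ j : (thetaIndex X).LabelStar, Set ((logShellsDH X logv).GlobalPacket j.1))
  (region : ℤ → ∀ j : (thetaIndex X).LabelStar, FinDivisor M → ∀ vQ : (thetaIndex X).VQ,
    Set ((logShellsDH X logv).Packet j.1 vQ))
  (n : ℤ) {HT : Type} {LogLink : HT → HT → Type} {IsFull : ∀ {s t : HT}, LogLink s t → Prop}
  (lat : LGPGaussianLogThetaLattice LogLink IsFull)
  {Frd : Type} {IsoF : Frd → Frd → Type} {Ob : Frd → Type} {realify : Frd → Frd} {Strip : Type}
  {IsoS : Strip → Strip → Type} {Mv : ∀ v : (thetaIndex X).V, v ∈ (thetaIndex X).Vbad → Type}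
  [∀ v h, Monoid (Mv v h)]
  (sig : GlobalLGPFrobenioidSignature (thetaIndex X).lstar (thetaIndex X).V (· ∈ (thetaIndex X).Vbad)
    Frd IsoF Ob realify Strip IsoS Mv)
  (split : SplittingMonoids Mv) {ObΔ : Type} {N : ∀ v : (thetaIndex X).V, v ∈ (thetaIndex X).Vbad → Type}
  [∀ v h, Monoid (N v h)] (qData : QPilotData ObΔ N)
  (t : ∀ (pp : Nat.Primes) (_ : Fin X.lstar) (x : (thetaIndex X).Fibre (.inr pp)),
    haveI : Fact (pp : ℕ).Prime := ⟨pp.2⟩; kOf X pp.1 x)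
  (tq : ∀ (pp : Nat.Primes) (x : (thetaIndex X).Fibre (.inr pp)), haveI : Fact (pp : ℕ).Prime := ⟨pp.2⟩; kOf X pp.1 x)

/-- **Every local Θ-term of the trivial configuration is `≥ 0`** (box ≤ hull; the (Ind3)-region of `𝟙` is the unit box, of
log-volume `0`). [cite: DupuyHilado2025, §3.9] -/
theorem thetaLocal_untopD_settingPrVolSharp_trivial_nonneg (i : Fin (thetaIndex X).lstar) (vQ : (thetaIndex X).VQ) :
    0 ≤ ((settingPrVolSharp X hlog M archPk archSub Ψ act Mmod region n lat sig split qData (fun _ _ => 1) (fun _ _ _ => 1)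
      (fun _ _ => one_ne_zero) (fun _ _ _ => norm_one)).thetaLocal (Setting.labelSucc i) vQ).untopD 0 := by
  rcases vQ with u | pp
  · exact (thetaLocal_settingPrVol_untopD_inl X hlog M archPk archSub Ψ act Mmod region n lat sig split qData _ _ _ _ u i
      (bridgeHyps_settingPrVolSharp_of_ideles X hlog M archPk archSub Ψ act Mmod region n lat sig split qData
        (fun _ _ _ => 1) (fun _ _ => 1) (fun _ _ _ => one_ne_zero) (fun _ _ _ _ => norm_one) (fun _ _ => one_ne_zero)
        (fun _ _ _ => norm_one))).ge
  · haveI : Fact (pp : ℕ).Prime := ⟨pp.2⟩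
    refine le_trans (le_of_eq ?_) (sum_weightPr_log_le_thetaLocal_untopD_settingPrVolSharp X hlog M archPk archSub Ψ act
      Mmod region n lat sig split qData (fun _ _ _ => 1) (fun _ _ => 1) (fun _ _ _ => one_ne_zero) (fun _ _ _ _ => norm_one)
      (fun _ _ => one_ne_zero) (fun _ _ _ => norm_one) i pp)
    refine (Finset.sum_eq_zero fun e _ => ?_).symm
    rw [norm_one, Real.log_one, mul_zero]

open Literature.NumberTheory.NumberFields in
/-- **`−|log(Θ)|(𝟙) > 0` AT A RAMIFIED BASE FIELD.** If `F` has a place `v` over a prime `p` not under `S` with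
ramification index `2 ≤ e_v ≤ |S^±_{i+2}| = i+2` for some index `i`, then the Θ-volume of the trivial configuration at
`Real.settingPrVolSharp` is STRICTLY POSITIVE: every local term is `≥ 0` and the one at `(i+1, p)` is `> 0` by
abc-iut-c312-5's ramified hull gain (the typed (Ind1)/(Ind2)-hull of the unit boxes inflates at a ramified packet).
[cite: DupuyHilado2025, §3.9, §4.9] [claim: Mochizuki2012, status: disputed] -/
theorem negLogTheta_settingPrVolSharp_trivial_pos_of_ramified (i : Fin (thetaIndex X).lstar) (pp : Nat.Primes)
    (hS : ∀ x : (thetaIndex X).Fibre (.inr pp), haveI : Fact (pp : ℕ).Prime := ⟨pp.2⟩; placeOf X pp.1 x ∉ X.S)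
    (v : HeightOneSpectrum (𝓞 F)) (hv : (thetaIndex X).over (.inr v) = .inr pp) (hvp : ((pp : ℕ) : 𝓞 F) ∈ v.asIdeal)
    (he : haveI : Fact (pp : ℕ).Prime := ⟨pp.2⟩; 2 ≤ absRamificationIdx (pp : ℕ) (RescaledCompletion F (pp : ℕ) v hvp))
    (hei : haveI : Fact (pp : ℕ).Prime := ⟨pp.2⟩; absRamificationIdx (pp : ℕ) (RescaledCompletion F (pp : ℕ) v hvp) ≤
      Fintype.card ((thetaIndex X).Caps (Setting.labelSucc i))) :
    (0 : WithTop ℝ) <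
      (settingPrVolSharp X hlog M archPk archSub Ψ act Mmod region n lat sig split qData (fun _ _ => 1) (fun _ _ _ => 1)
        (fun _ _ => one_ne_zero) (fun _ _ _ => norm_one)).negLogTheta := by
  haveI : Fact (pp : ℕ).Prime := ⟨pp.2⟩
  have hfinΘ₁ := thetaFinite_settingPrVolSharp X hlog M archPk archSub Ψ act Mmod region n lat sig split qData
    (fun _ _ _ => 1) (fun _ _ => 1) (fun _ _ _ => one_ne_zero) (fun _ _ _ _ => norm_one) (fun _ _ => one_ne_zero)
    (fun _ _ _ => norm_one)
  have hloc := thetaLocal_settingPrVolSharp_pos_of_ramified X hlog M archPk archSub Ψ act Mmod region n (fun _ _ _ => 1)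
    (fun _ _ => 1) lat sig split qData (fun _ _ _ => one_ne_zero) (fun _ _ _ _ => norm_one) (fun _ _ => one_ne_zero)
    (fun _ _ _ => norm_one) i pp hS v hv hvp he hei
  have hnn := thetaLocal_untopD_settingPrVolSharp_trivial_nonneg X hlog M archPk archSub Ψ act Mmod region n lat sig split
    qData
  -- the positive local term, read in `ℝ`
  have hpos : 0 < ((settingPrVolSharp X hlog M archPk archSub Ψ act Mmod region n lat sig split qData (fun _ _ => 1)
      (fun _ _ _ => 1) (fun _ _ => one_ne_zero) (fun _ _ _ => norm_one)).thetaLocal (Setting.labelSucc i)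
        (.inr pp)).untopD 0 := by
    obtain ⟨r, hr⟩ := WithTop.ne_top_iff_exists.mp (hfinΘ₁.1 i (.inr pp))
    rw [← hr] at hloc
    rw [← hr, WithTop.untopD_coe]
    exact WithTop.coe_pos.mp hloc
  unfold Setting.negLogTheta
  rw [if_pos hfinΘ₁]
  refine WithTop.coe_pos.mpr ?_
  have hlt : (0 : ℝ) < ∑ᶠ vQ : (thetaIndex X).VQ,
      ((settingPrVolSharp X hlog M archPk archSub Ψ act Mmod region n lat sig split qData (fun _ _ => 1) (fun _ _ _ => 1)
        (fun _ _ => one_ne_zero) (fun _ _ _ => norm_one)).thetaLocal (Setting.labelSucc i) vQ).untopD 0 :=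
    hpos.trans_le (single_le_finsum (Sum.inr pp) (hfinΘ₁.2 i) (hnn i))
  have h0 : processionNormalized (fun _ : Fin (thetaIndex X).lstar => (0 : ℝ)) = 0 := by
    unfold processionNormalized; rw [Finset.sum_const_zero, zero_div]
  have h := processionNormalized_lt_of_le_of_lt (Fin.pos i) (f := fun _ : Fin (thetaIndex X).lstar => (0 : ℝ))
    (fun i' => finsum_nonneg (hnn i')) hlt
  rwa [h0] at h

open Literature.NumberTheory.NumberFields in
/-- **THE EXACT CRITERION WITH A POSITIVE SHIFT AT A RAMIFIED BASE FIELD.** Under the ramification hypothesis of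
`negLogTheta_settingPrVolSharp_trivial_pos_of_ramified`, for every context there is a real number `κ > 0`
(`= −|log(Θ)|(𝟙)`) such that for EVERY pilot ideles whose bad places lie over a finite set `U` of odd primes unramified in
`F` (Θ-exponents `m`, `q`-exponents `m_q` over `U`):
`Statement(t_q, t) ⟺ Qside − Θside ≤ κ`.
So part 8's positive half `Qside ≤ Θside ⟹ Statement` (p437123) was NOT sharp there: the typed Corollary 3.12 also HOLDS
at genuine sharp data whose `q`-exponent mass exceeds the slot-symmetrised Θ-exponent mass by up to `κ` — by the hull
inflation of the UNIT boxes at the ramified prime, not by the disputed inference; and it FAILS exactly beyond `κ`. No side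
taken on [IUTchIII] Cor. 3.12. [claim: Mochizuki2012, status: disputed] [cite: DupuyHilado2025, §3.6, §3.9, §4.7, §4.9] -/
theorem settingPrVolSharp_regime_exact_pos_of_ramified (i₀ : Fin (thetaIndex X).lstar) (p₀ : Nat.Primes)
    (hS : ∀ x : (thetaIndex X).Fibre (.inr p₀), haveI : Fact (p₀ : ℕ).Prime := ⟨p₀.2⟩; placeOf X p₀.1 x ∉ X.S)
    (v : HeightOneSpectrum (𝓞 F)) (hv : (thetaIndex X).over (.inr v) = .inr p₀) (hvp : ((p₀ : ℕ) : 𝓞 F) ∈ v.asIdeal)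
    (he : haveI : Fact (p₀ : ℕ).Prime := ⟨p₀.2⟩; 2 ≤ absRamificationIdx (p₀ : ℕ) (RescaledCompletion F (p₀ : ℕ) v hvp))
    (hei : haveI : Fact (p₀ : ℕ).Prime := ⟨p₀.2⟩; absRamificationIdx (p₀ : ℕ) (RescaledCompletion F (p₀ : ℕ) v hvp) ≤
      Fintype.card ((thetaIndex X).Caps (Setting.labelSucc i₀)))
    (U : Finset Nat.Primes)
    (hU : ∀ (pp : Nat.Primes) (x : (thetaIndex X).Fibre (.inr pp)),
      haveI : Fact (pp : ℕ).Prime := ⟨pp.2⟩; placeOf X pp.1 x ∈ X.S → pp ∈ U)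
    (hU2 : ∀ pp ∈ U, 2 < (pp : ℕ)) (hUd : ∀ pp ∈ U, ¬ ((pp : ℕ) : ℤ) ∣ NumberField.discr F) :
    ∃ κ : ℝ, 0 < κ ∧
      (settingPrVolSharp X hlog M archPk archSub Ψ act Mmod region n lat sig split qData (fun _ _ => 1) (fun _ _ _ => 1)
          (fun _ _ => one_ne_zero) (fun _ _ _ => norm_one)).negLogTheta = ((κ : ℝ) : WithTop ℝ) ∧
      ∀ (tq : ∀ (pp : Nat.Primes) (x : (thetaIndex X).Fibre (.inr pp)), haveI : Fact (pp : ℕ).Prime := ⟨pp.2⟩; kOf X pp.1 x)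
        (t : ∀ (pp : Nat.Primes) (_ : Fin X.lstar) (x : (thetaIndex X).Fibre (.inr pp)),
          haveI : Fact (pp : ℕ).Prime := ⟨pp.2⟩; kOf X pp.1 x)
        (ht0 : ∀ pp i x, t pp i x ≠ 0)
        (_ : ∀ (pp : Nat.Primes) (i : Fin X.lstar) (x : (thetaIndex X).Fibre (.inr pp)),
          haveI : Fact (pp : ℕ).Prime := ⟨pp.2⟩; placeOf X pp.1 x ∉ X.S → ‖t pp i x‖ = 1)
        (htq0 : ∀ pp x, tq pp x ≠ 0)
        (htq1 : ∀ (pp : Nat.Primes) (x : (thetaIndex X).Fibre (.inr pp)),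
          haveI : Fact (pp : ℕ).Prime := ⟨pp.2⟩; placeOf X pp.1 x ∉ X.S → ‖tq pp x‖ = 1)
        (m : ∀ pp : Nat.Primes, Fin (thetaIndex X).lstar → (thetaIndex X).Fibre (.inr pp) → ℤ),
        (∀ (pp : Nat.Primes), pp ∈ U → ∀ (i : Fin (thetaIndex X).lstar) (x : (thetaIndex X).Fibre (.inr pp)),
          haveI : Fact (pp : ℕ).Prime := ⟨pp.2⟩; ‖t pp i x‖ = ‖((pp : ℕ) : ℚ_[pp]) ^ m pp i x‖) →
        ∀ (mq : ∀ pp : Nat.Primes, (thetaIndex X).Fibre (.inr pp) → ℤ),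
        (∀ (pp : Nat.Primes), pp ∈ U → ∀ (x : (thetaIndex X).Fibre (.inr pp)),
          haveI : Fact (pp : ℕ).Prime := ⟨pp.2⟩; ‖tq pp x‖ = ‖((pp : ℕ) : ℚ_[pp]) ^ mq pp x‖) →
        ((settingPrVolSharp X hlog M archPk archSub Ψ act Mmod region n lat sig split qData tq t htq0 htq1).Statement ↔
          processionNormalized (fun i : Fin (thetaIndex X).lstar => ∑ pp ∈ U,
              (haveI : Fact (pp : ℕ).Prime := ⟨pp.2⟩;
                ∑ e : (presAt X hlog pp).toLocalPieces.E (Setting.labelSucc i),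
                  weightPr X pp.1 (Setting.labelSucc i) e * (-(mq pp (e (Fin.last _))) * Real.log (pp : ℕ)))) -
            processionNormalized (fun i : Fin (thetaIndex X).lstar => ∑ pp ∈ U,
              (haveI : Fact (pp : ℕ).Prime := ⟨pp.2⟩;
                ∑ e : (presAt X hlog pp).toLocalPieces.E (Setting.labelSucc i),
                  weightPr X pp.1 (Setting.labelSucc i) e *
                    (-(Finset.univ.inf' Finset.univ_nonempty (fun a => m pp i (e a)) * Real.log (pp : ℕ))))) ≤ κ) := by
  have hpos := negLogTheta_settingPrVolSharp_trivial_pos_of_ramified X hlog M archPk archSub Ψ act Mmod region n lat sig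
    split qData i₀ p₀ hS v hv hvp he hei
  obtain ⟨κ, hκ⟩ := WithTop.ne_top_iff_exists.mp (negLogTheta_settingPrVolSharp_trivial_ne_top X hlog M archPk archSub Ψ
    act Mmod region n lat sig split qData)
  refine ⟨κ, ?_, hκ.symm, ?_⟩
  · rw [← hκ] at hpos
    exact WithTop.coe_pos.mp hpos
  intro tq t ht0 ht1 htq0 htq1 m hm mq hmq
  rw [statement_settingPrVolSharp_iff_exact X hlog M archPk archSub Ψ act Mmod region n lat sig split qData t tq ht0 ht1
    htq0 htq1 U hU hU2 hUd m hm mq hmq, ← hκ, WithTop.coe_le_coe]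

open Literature.NumberTheory.NumberFields in
/-- **`−|log(Θ)|(𝟙) > 0` FOR EVERY BASE FIELD OF GENUINE Θ-DATA**: if `√−1 ∈ F` ([IUTchI] Def. 3.1 (a)), no place of
`S` lies over `2` (Def. 3.1 (b): `𝕍^bad` of odd residue characteristic) and some place `v | 2` of `F` has
`e_v ≤ |S^±_{i+2}| = i+2` for some index `i` (e.g. `e_v ≤ l⋆ + 1`), then the Θ-volume of the trivial configuration at
`Real.settingPrVolSharp` is STRICTLY POSITIVE (abc-iut-c312-5's dyadic ramified gain: `√−1 ∈ F_v` forces `e_v ≥ 2`).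
[cite: Mochizuki2012, IUTchI Def. 3.1 (a)(b) p. 61] [cite: DupuyHilado2025, §3.9, §4.9] [claim: Mochizuki2012, status: disputed] -/
theorem negLogTheta_settingPrVolSharp_trivial_pos_of_sq_eq_neg_one (r : F) (hr : r ^ 2 = -1)
    (i : Fin (thetaIndex X).lstar)
    (hS : ∀ x : (thetaIndex X).Fibre (.inr ⟨2, Nat.prime_two⟩), placeOf X 2 x ∉ X.S)
    (v : HeightOneSpectrum (𝓞 F)) (hv : (thetaIndex X).over (.inr v) = .inr ⟨2, Nat.prime_two⟩)
    (hvp : ((2 : ℕ) : 𝓞 F) ∈ v.asIdeal)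
    (hei : absRamificationIdx 2 (RescaledCompletion F 2 v hvp) ≤ Fintype.card ((thetaIndex X).Caps (Setting.labelSucc i))) :
    (0 : WithTop ℝ) <
      (settingPrVolSharp X hlog M archPk archSub Ψ act Mmod region n lat sig split qData (fun _ _ => 1) (fun _ _ _ => 1)
        (fun _ _ => one_ne_zero) (fun _ _ _ => norm_one)).negLogTheta :=
  negLogTheta_settingPrVolSharp_trivial_pos_of_ramified X hlog M archPk archSub Ψ act Mmod region n lat sig split qData i
    ⟨2, Nat.prime_two⟩ hS v hv hvp (two_le_absRamificationIdx_rescaledCompletion_two_of_sq_eq_neg_one r hr v hvp) hei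

open Literature.NumberTheory.NumberFields in
/-- **The exact criterion with a positive shift, for every base field of genuine Θ-data** (`√−1 ∈ F`, no place of `S`
over `2`, some `v | 2` with `e_v ≤ i₀+2`): for every context there is a real `κ > 0` (`= −|log(Θ)|(𝟙)`) with
`Statement(t_q, t) ⟺ Qside − Θside ≤ κ` for all pilot ideles whose bad places lie over a finite set of odd primes
unramified in `F`. No side taken on [IUTchIII] Cor. 3.12. [cite: Mochizuki2012, IUTchI Def. 3.1 (a)(b) p. 61]
[claim: Mochizuki2012, status: disputed] [cite: DupuyHilado2025, §3.6, §3.9, §4.7, §4.9] -/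
theorem settingPrVolSharp_regime_exact_pos_of_sq_eq_neg_one (r : F) (hr : r ^ 2 = -1) (i₀ : Fin (thetaIndex X).lstar)
    (hS : ∀ x : (thetaIndex X).Fibre (.inr ⟨2, Nat.prime_two⟩), placeOf X 2 x ∉ X.S)
    (v : HeightOneSpectrum (𝓞 F)) (hv : (thetaIndex X).over (.inr v) = .inr ⟨2, Nat.prime_two⟩)
    (hvp : ((2 : ℕ) : 𝓞 F) ∈ v.asIdeal)
    (hei : absRamificationIdx 2 (RescaledCompletion F 2 v hvp) ≤ Fintype.card ((thetaIndex X).Caps (Setting.labelSucc i₀)))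
    (U : Finset Nat.Primes)
    (hU : ∀ (pp : Nat.Primes) (x : (thetaIndex X).Fibre (.inr pp)),
      haveI : Fact (pp : ℕ).Prime := ⟨pp.2⟩; placeOf X pp.1 x ∈ X.S → pp ∈ U)
    (hU2 : ∀ pp ∈ U, 2 < (pp : ℕ)) (hUd : ∀ pp ∈ U, ¬ ((pp : ℕ) : ℤ) ∣ NumberField.discr F) :
    ∃ κ : ℝ, 0 < κ ∧
      (settingPrVolSharp X hlog M archPk archSub Ψ act Mmod region n lat sig split qData (fun _ _ => 1) (fun _ _ _ => 1)
          (fun _ _ => one_ne_zero) (fun _ _ _ => norm_one)).negLogTheta = ((κ : ℝ) : WithTop ℝ) ∧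
      ∀ (tq : ∀ (pp : Nat.Primes) (x : (thetaIndex X).Fibre (.inr pp)), haveI : Fact (pp : ℕ).Prime := ⟨pp.2⟩; kOf X pp.1 x)
        (t : ∀ (pp : Nat.Primes) (_ : Fin X.lstar) (x : (thetaIndex X).Fibre (.inr pp)),
          haveI : Fact (pp : ℕ).Prime := ⟨pp.2⟩; kOf X pp.1 x)
        (ht0 : ∀ pp i x, t pp i x ≠ 0)
        (_ : ∀ (pp : Nat.Primes) (i : Fin X.lstar) (x : (thetaIndex X).Fibre (.inr pp)),
          haveI : Fact (pp : ℕ).Prime := ⟨pp.2⟩; placeOf X pp.1 x ∉ X.S → ‖t pp i x‖ = 1)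
        (htq0 : ∀ pp x, tq pp x ≠ 0)
        (htq1 : ∀ (pp : Nat.Primes) (x : (thetaIndex X).Fibre (.inr pp)),
          haveI : Fact (pp : ℕ).Prime := ⟨pp.2⟩; placeOf X pp.1 x ∉ X.S → ‖tq pp x‖ = 1)
        (m : ∀ pp : Nat.Primes, Fin (thetaIndex X).lstar → (thetaIndex X).Fibre (.inr pp) → ℤ),
        (∀ (pp : Nat.Primes), pp ∈ U → ∀ (i : Fin (thetaIndex X).lstar) (x : (thetaIndex X).Fibre (.inr pp)),
          haveI : Fact (pp : ℕ).Prime := ⟨pp.2⟩; ‖t pp i x‖ = ‖((pp : ℕ) : ℚ_[pp]) ^ m pp i x‖) →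
        ∀ (mq : ∀ pp : Nat.Primes, (thetaIndex X).Fibre (.inr pp) → ℤ),
        (∀ (pp : Nat.Primes), pp ∈ U → ∀ (x : (thetaIndex X).Fibre (.inr pp)),
          haveI : Fact (pp : ℕ).Prime := ⟨pp.2⟩; ‖tq pp x‖ = ‖((pp : ℕ) : ℚ_[pp]) ^ mq pp x‖) →
        ((settingPrVolSharp X hlog M archPk archSub Ψ act Mmod region n lat sig split qData tq t htq0 htq1).Statement ↔
          processionNormalized (fun i : Fin (thetaIndex X).lstar => ∑ pp ∈ U,
              (haveI : Fact (pp : ℕ).Prime := ⟨pp.2⟩;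
                ∑ e : (presAt X hlog pp).toLocalPieces.E (Setting.labelSucc i),
                  weightPr X pp.1 (Setting.labelSucc i) e * (-(mq pp (e (Fin.last _))) * Real.log (pp : ℕ)))) -
            processionNormalized (fun i : Fin (thetaIndex X).lstar => ∑ pp ∈ U,
              (haveI : Fact (pp : ℕ).Prime := ⟨pp.2⟩;
                ∑ e : (presAt X hlog pp).toLocalPieces.E (Setting.labelSucc i),
                  weightPr X pp.1 (Setting.labelSucc i) e *
                    (-(Finset.univ.inf' Finset.univ_nonempty (fun a => m pp i (e a)) * Real.log (pp : ℕ))))) ≤ κ) :=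
  settingPrVolSharp_regime_exact_pos_of_ramified X hlog M archPk archSub Ψ act Mmod region n lat sig split qData i₀
    ⟨2, Nat.prime_two⟩ hS v hv hvp (two_le_absRamificationIdx_rescaledCompletion_two_of_sq_eq_neg_one r hr v hvp) hei U hU
    hU2 hUd

end Ramified

end Real

end Thm311

end IUTFork

end Summit.ABC

end
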